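import Literature.AnabelianGeometry.EtaleTheta.ContH1Complements
import Literature.NumberTheory.GaloisRepresentations.ProfiniteContinuousSection
import HarnessLib

/-!
# Continuous `H¹` and CLOSED complements of a compact abelian normal subgroup: the complements, modulo
# conjugation, form a torsor under `Ker(res)` ([GalSect] §4 «the splittings … form a torsor over H¹», group side)

Classical group cohomology (Brown, *Cohomology of Groups*, Ch. IV §2, Prop. 2.3: the `A`-conjugacy classes of
complements of an abelian normal subgroup `A` in a split extension are a torsor under `H¹` of the quotient)
[cite: Brown1982CohomologyGroups, Ch. IV §2 Prop. 2.1 and Prop. 2.3], in the continuous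
crossed-homomorphism model `ContH1` of the cell (abc-iut-L2-t1, `ContH1.lean`;
[cite: NeukirchSchmidtWingberg2008, I §2 and II §7]); the motivating printed sentence is S. Mochizuki,
*Galois sections in absolute anabelian geometry* [GalSect], Nagoya Math. J. **179** (2005), §4 p.33: "the
splittings of `1 → I_x → D_x → G_K → 1` … form a torsor over `H¹(G_K, Ẑ(1))`"
[cite: MochizukiGalSect2005, §4 p.33] (that instance is the sequel `GalSectSplittingsCohomology`).

Setting: a topological group `E`, an abelian normal subgroup `A ≤ E`, a subgroup `H ≥ A`.  A **closed
complement** of `A` in `H` is a closed `K ≤ H` with `A ⊓ K = ⊥`, `A ⊔ K = H`.  Building on abc-iut-L2-t12's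
`ContH1Complements` (continuous coordinate ⇒ class; class restricting to `[id]` ⇒ algebraic complement with
continuous retraction), this PROOF file (definitions: the coordinate `coord`, the class `classOf`, the
conjugacy setoid / quotient `ComplementClass`, the set `idFibre`; seat abc-iut-w5-d029) adds:

* `continuous_coord` — for `A` COMPACT, the `A`-coordinate of a CLOSED complement is automatically
  continuous (closed-graph theorem into the compact `A`; the tree's `continuous_of_isClosed_graph`);
* `classOf K ∈ H¹(H, A)` with `res (classOf K) = [id]` (`res_classOf`);
* `classOf_conj` / `eq_conj_of_classOf_eq` — two closed complements have the same class iff they are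
  `A`-conjugate;
* `exists_closedComplement_classOf_eq` — for `H` closed, every class restricting to `[id]` is a `classOf`;
* hence `complementClassEquivIdFibre : ComplementClass ≃ idFibre` (`idFibre = {x | res x = [id]}`), and the
  latter is a COSET of `resKer := Ker(res : H¹(H, A) → H¹(A, A))` (`idFibreEquivResKer`), so the
  conjugacy classes of closed complements form a torsor under `resKer` (`≅ H¹(H/A, A)` by
  inflation–restriction — not needed, not typed).

Classical; nothing of [EtTh]/[GalSect] is asserted here; no side taken on [IUTchIII] Cor. 3.12.
-/

noncomputable section

namespace Literature.AnabelianGeometry.EtaleTheta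

open scoped IsMulCommutative
open scoped Pointwise

namespace ContH1

variable {E : Type*} [Group E] [TopologicalSpace E] [IsTopologicalGroup E]
  {A : Subgroup E} [A.Normal] [IsMulCommutative A] {H : Subgroup E}

/-- A **closed complement** of `A` in `H`: a closed subgroup `K ≤ H` with `A ⊓ K = ⊥` and `A ⊔ K = H`
(the "splittings" of `1 → A → H → H/A → 1`, recorded by their images, as in [GalSect] §4).
[cite: MochizukiGalSect2005, §4 p.33] -/
structure IsClosedComplement (A H K : Subgroup E) : Prop where
  /-- `K` is closed -/
  isClosed : IsClosed (K : Set E)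
  /-- `K ≤ H` -/
  le : K ≤ H
  /-- `A ⊓ K = ⊥` -/
  disjoint : Disjoint A K
  /-- `A ⊔ K = H` -/
  sup_eq : A ⊔ K = H

namespace IsClosedComplement

variable {K : Subgroup E}

omit [A.Normal] [IsMulCommutative A] [IsTopologicalGroup E] in
/-- `A ≤ H`. [cite: Brown1982CohomologyGroups, Ch. IV §2 Prop. 2.1 and Prop. 2.3] -/
theorem le_left (hK : IsClosedComplement A H K) : A ≤ H := le_sup_left.trans hK.sup_eq.le

omit [IsMulCommutative A] [IsTopologicalGroup E] in
/-- Every `h ∈ H` is `a · k` with `a ∈ A`, `k ∈ K` (`A` normal: `A ⊔ K = A · K`).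
[cite: Brown1982CohomologyGroups, Ch. IV §2 Prop. 2.1 and Prop. 2.3] -/
theorem exists_mul_eq (hK : IsClosedComplement A H K) (h : H) :
    ∃ a ∈ A, ∃ k ∈ K, a * k = (h : E) := by
  have hh : (h : E) ∈ ((A ⊔ K : Subgroup E) : Set E) := by rw [hK.sup_eq]; exact h.2
  rw [Subgroup.normal_mul] at hh
  obtain ⟨a, ha, k, hk, hak⟩ := Set.mem_mul.mp hh
  exact ⟨a, ha, k, hk, hak⟩

/-- **The `A`-coordinate** `π : H → A` of the decomposition `H = A · K`.
[cite: Brown1982CohomologyGroups, Ch. IV §2 Prop. 2.1 and Prop. 2.3] -/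
def coord (hK : IsClosedComplement A H K) (h : H) : A :=
  ⟨(hK.exists_mul_eq h).choose, (hK.exists_mul_eq h).choose_spec.1⟩

omit [IsMulCommutative A] [IsTopologicalGroup E] in
/-- `π(h)⁻¹ h ∈ K`. [cite: Brown1982CohomologyGroups, Ch. IV §2 Prop. 2.1 and Prop. 2.3] -/
theorem coord_inv_mul_mem (hK : IsClosedComplement A H K) (h : H) :
    ((hK.coord h : E))⁻¹ * (h : E) ∈ K := by
  obtain ⟨k, hk, hak⟩ := (hK.exists_mul_eq h).choose_spec.2
  have : ((hK.coord h : E))⁻¹ * (h : E) = k := by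
    rw [← hak, ← mul_assoc]
    change ((hK.exists_mul_eq h).choose)⁻¹ * (hK.exists_mul_eq h).choose * k = k
    rw [inv_mul_cancel, one_mul]
  rw [this]
  exact hk

omit [IsMulCommutative A] [IsTopologicalGroup E] in
/-- **Uniqueness of the coordinate**: if `a⁻¹ h ∈ K` with `a ∈ A` then `a = π(h)`.
[cite: Brown1982CohomologyGroups, Ch. IV §2 Prop. 2.1 and Prop. 2.3] -/
theorem coord_eq_of_inv_mul_mem (hK : IsClosedComplement A H K) (h : H) {a : E} (ha : a ∈ A)
    (hak : a⁻¹ * (h : E) ∈ K) : (hK.coord h : E) = a := by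
  refine eq_of_mul_eq_mul_of_complement hK.disjoint (hK.coord h).2 ha (hK.coord_inv_mul_mem h) hak ?_
  rw [mul_inv_cancel_left, mul_inv_cancel_left]

omit [IsMulCommutative A] [IsTopologicalGroup E] in
/-- Characterisation: `π(h) = a ↔ a⁻¹ h ∈ K` (`a ∈ A`). [cite: Brown1982CohomologyGroups, Ch. IV §2 Prop. 2.1 and Prop. 2.3] -/
theorem coord_eq_iff (hK : IsClosedComplement A H K) (h : H) (a : A) :
    hK.coord h = a ↔ ((a : E))⁻¹ * (h : E) ∈ K := by
  constructor
  · rintro rfl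
    exact hK.coord_inv_mul_mem h
  · intro hak
    exact Subtype.ext (hK.coord_eq_of_inv_mul_mem h a.2 hak)

omit [IsMulCommutative A] [IsTopologicalGroup E] in
/-- `π` is the identity on `A`. [cite: Brown1982CohomologyGroups, Ch. IV §2 Prop. 2.1 and Prop. 2.3] -/
theorem coord_apply_of_mem (hK : IsClosedComplement A H K) (a : A) :
    hK.coord ⟨a, hK.le_left a.2⟩ = a :=
  (hK.coord_eq_iff _ a).mpr (by rw [inv_mul_cancel]; exact one_mem K)

omit [IsMulCommutative A] [IsTopologicalGroup E] in
/-- `π(k) = 1` for `k ∈ K`. [cite: Brown1982CohomologyGroups, Ch. IV §2 Prop. 2.1 and Prop. 2.3] -/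
theorem coord_apply_of_mem_right (hK : IsClosedComplement A H K) {k : E} (hk : k ∈ K) :
    hK.coord ⟨k, hK.le hk⟩ = 1 :=
  (hK.coord_eq_iff _ 1).mpr (by rw [Subgroup.coe_one, inv_one, one_mul]; exact hk)

omit [IsMulCommutative A] [IsTopologicalGroup E] in
/-- `k ∈ K ↔ π(k) = 1` on `H`. [cite: Brown1982CohomologyGroups, Ch. IV §2 Prop. 2.1 and Prop. 2.3] -/
theorem mem_iff_coord_eq_one (hK : IsClosedComplement A H K) (h : H) : (h : E) ∈ K ↔ hK.coord h = 1 := by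
  rw [hK.coord_eq_iff, Subgroup.coe_one, inv_one, one_mul]

omit [IsMulCommutative A] in
/-- **Continuity of the coordinate for COMPACT `A`** (closed-graph theorem: the graph
`{(h, a) | a⁻¹ h ∈ K}` is closed because `K` is). [cite: Brown1982CohomologyGroups, Ch. IV §2 Prop. 2.1 and Prop. 2.3] -/
theorem continuous_coord (hK : IsClosedComplement A H K) (hA : IsCompact (A : Set E)) :
    Continuous hK.coord := by
  haveI : CompactSpace A := isCompact_iff_compactSpace.mp hA
  apply Literature.NumberTheory.GaloisRepresentations.continuous_of_isClosed_graph
  have hset : {q : H × A | hK.coord q.1 = q.2} = (fun q : H × A => ((q.2 : E))⁻¹ * (q.1 : E)) ⁻¹' (K : Set E) := by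
    ext q
    exact hK.coord_eq_iff q.1 q.2
  rw [hset]
  exact hK.isClosed.preimage (by fun_prop)

omit [IsTopologicalGroup E] in
/-- **The crossed law**: `π(hh') = π(h) · h π(h') h⁻¹` (conjugation action on the abelian `A`).
[cite: Brown1982CohomologyGroups, Ch. IV §2 Prop. 2.1 and Prop. 2.3] -/
theorem coord_mul (hK : IsClosedComplement A H K) (h h' : H) :
    hK.coord (h * h') = hK.coord h * MulAut.conjNormal ((MonoidHom.id E) (h : E)) (hK.coord h') := by
  have hKN : K ≤ Subgroup.normalizer (A : Set E) := Subgroup.le_normalizer_of_normal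
  have hlaw := coe_proj_mul_of_complement (H := H) hKN hK.disjoint hK.coord hK.coord_inv_mul_mem h h'
  apply Subtype.ext
  rw [Subgroup.coe_mul, MulAut.conjNormal_apply, MonoidHom.id_apply, hlaw]
  -- `k π(h') k⁻¹ = h π(h') h⁻¹` with `k = π(h)⁻¹ h`, since `π(h) ∈ A` commutes with `h π(h') h⁻¹ ∈ A`
  set π := hK.coord with hπ
  have hA' : (h : E) * (π h' : E) * (h : E)⁻¹ ∈ A := (inferInstance : A.Normal).conj_mem _ (π h').2 _
  have hcomm : ((π h : E))⁻¹ * ((h : E) * (π h' : E) * (h : E)⁻¹) =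
      ((h : E) * (π h' : E) * (h : E)⁻¹) * ((π h : E))⁻¹ :=
    setLike_mul_comm (s := A) (A.inv_mem (π h).2) hA'
  congr 1
  calc ((π h : E))⁻¹ * (h : E) * (π h' : E) * (((π h : E))⁻¹ * (h : E))⁻¹
      = ((π h : E))⁻¹ * ((h : E) * (π h' : E) * (h : E)⁻¹) * (π h : E) := by group
    _ = (h : E) * (π h' : E) * (h : E)⁻¹ := by rw [hcomm, mul_assoc, inv_mul_cancel, mul_one]

/-- The coordinate is a continuous cocycle (for compact `A`). [cite: Brown1982CohomologyGroups, Ch. IV §2 Prop. 2.1 and Prop. 2.3] -/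
theorem coord_mem_contCocycles (hK : IsClosedComplement A H K) (hA : IsCompact (A : Set E)) :
    hK.coord ∈ contCocycles (MonoidHom.id E) A H :=
  ⟨hK.continuous_coord hA, hK.coord_mul⟩

/-- **The class of a closed complement**, `[π_K] ∈ H¹(H, A)`. [cite: Brown1982CohomologyGroups, Ch. IV §2 Prop. 2.1 and Prop. 2.3] -/
def classOf (hK : IsClosedComplement A H K) (hA : IsCompact (A : Set E)) : ContH1 (MonoidHom.id E) A H :=
  ContH1.mk hK.coord (hK.coord_mem_contCocycles hA)

/-- `res_A [π_K] = [id]`. [cite: Brown1982CohomologyGroups, Ch. IV §2 Prop. 2.1 and Prop. 2.3] -/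
theorem res_classOf (hK : IsClosedComplement A H K) (hA : IsCompact (A : Set E)) :
    ContH1.res (MonoidHom.id E) A hK.le_left (hK.classOf hA) =
      ContH1.mk (fun a : A => a) id_mem_contCocycles := by
  change ContH1.mk _ (ContH1.resCocycle (MonoidHom.id E) A hK.le_left ⟨_, hK.coord_mem_contCocycles hA⟩).2 = _
  exact ContH1.mk_congr A (funext fun a => hK.coord_apply_of_mem a) _ _

/-! #### Conjugate complements -/

omit [A.Normal] [IsMulCommutative A] in
/-- Conjugating a closed complement by `a ∈ A` gives a closed complement.
[cite: Brown1982CohomologyGroups, Ch. IV §2 Prop. 2.1 and Prop. 2.3] -/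
theorem conj (hK : IsClosedComplement A H K) {a : E} (ha : a ∈ A) :
    IsClosedComplement A H (MulAut.conj a • K) where
  isClosed := by
    have : ((MulAut.conj a • K : Subgroup E) : Set E) = (fun y => a * y * a⁻¹) '' (K : Set E) := by
      ext y
      simp only [Subgroup.coe_pointwise_smul, Set.mem_smul_set, Set.mem_image, SetLike.mem_coe,
        MulAut.smul_def, MulAut.conj_apply]
    rw [this, show (fun y : E => a * y * a⁻¹) = (Homeomorph.mulRight a⁻¹) ∘ (Homeomorph.mulLeft a) from
      funext fun y => rfl, Set.image_comp]
    exact (Homeomorph.mulRight a⁻¹).isClosedMap _ ((Homeomorph.mulLeft a).isClosedMap _ hK.isClosed)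
  le := by
    rintro _ ⟨k, hk, rfl⟩
    exact H.mul_mem (H.mul_mem (hK.le_left ha) (hK.le hk)) (H.inv_mem (hK.le_left ha))
  disjoint := by
    rw [Subgroup.disjoint_def]
    rintro x hxA ⟨k, hk, rfl⟩
    have hkA : k ∈ A := by
      have : a⁻¹ * (a * k * a⁻¹) * a ∈ A := A.mul_mem (A.mul_mem (A.inv_mem ha) hxA) ha
      simpa [mul_assoc] using this
    have hk1 : k = 1 := (Subgroup.disjoint_def.mp hK.disjoint) hkA hk
    simp [hk1]
  sup_eq := by
    have hAa : MulAut.conj a • A = A := by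
      ext y
      rw [Subgroup.mem_smul_pointwise_iff_exists]
      constructor
      · rintro ⟨z, hz, rfl⟩
        exact A.mul_mem (A.mul_mem ha hz) (A.inv_mem ha)
      · intro hy
        exact ⟨a⁻¹ * y * a, A.mul_mem (A.mul_mem (A.inv_mem ha) hy) ha, by simp [MulAut.conj_apply, mul_assoc]⟩
    have hHa : MulAut.conj a • H = H := by
      ext y
      rw [Subgroup.mem_smul_pointwise_iff_exists]
      have haH := hK.le_left ha
      constructor
      · rintro ⟨z, hz, rfl⟩
        exact H.mul_mem (H.mul_mem haH hz) (H.inv_mem haH)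
      · intro hy
        exact ⟨a⁻¹ * y * a, H.mul_mem (H.mul_mem (H.inv_mem haH) hy) haH, by simp [MulAut.conj_apply, mul_assoc]⟩
    rw [← hAa, ← Subgroup.smul_sup, hK.sup_eq, hHa]

/-- The coordinate of the conjugate complement `aKa⁻¹`: `π'(h) = π(h) · (h a h⁻¹) · a⁻¹` — it differs
from `π` by the coboundary of `a`. [cite: Brown1982CohomologyGroups, Ch. IV §2 Prop. 2.1 and Prop. 2.3] -/
theorem coord_conj (hK : IsClosedComplement A H K) {a : E} (ha : a ∈ A) (h : H) :
    ((hK.conj ha).coord h : E) = (hK.coord h : E) * ((h : E) * a * (h : E)⁻¹ * a⁻¹) := by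
  apply (hK.conj ha).coord_eq_of_inv_mul_mem h
  · exact A.mul_mem (hK.coord h).2 (A.mul_mem ((inferInstance : A.Normal).conj_mem a ha _) (A.inv_mem ha))
  · -- `((π h)·(h a h⁻¹ a⁻¹))⁻¹ h = a (π(h)⁻¹ h) a⁻¹ ∈ a K a⁻¹`, using commutativity in `A`
    rw [Subgroup.mem_smul_pointwise_iff_exists]
    refine ⟨((hK.coord h : E))⁻¹ * (h : E), hK.coord_inv_mul_mem h, ?_⟩
    rw [MulAut.smul_def, MulAut.conj_apply]
    -- `(π · h a h⁻¹ a⁻¹)⁻¹ h = a (h a⁻¹ h⁻¹ · π⁻¹) h = a (π⁻¹ · h a⁻¹ h⁻¹) h = a (π⁻¹ h) a⁻¹`, commuting in `A`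
    have hc' : (h : E) * a⁻¹ * (h : E)⁻¹ ∈ A := (inferInstance : A.Normal).conj_mem _ (A.inv_mem ha) _
    have c1 : ((hK.coord h : E))⁻¹ * ((h : E) * a⁻¹ * (h : E)⁻¹) =
        ((h : E) * a⁻¹ * (h : E)⁻¹) * ((hK.coord h : E))⁻¹ :=
      setLike_mul_comm (s := A) (A.inv_mem (hK.coord h).2) hc'
    symm
    calc ((hK.coord h : E) * ((h : E) * a * (h : E)⁻¹ * a⁻¹))⁻¹ * (h : E)
        = a * (((h : E) * a⁻¹ * (h : E)⁻¹) * ((hK.coord h : E))⁻¹) * (h : E) := by group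
      _ = a * (((hK.coord h : E))⁻¹ * ((h : E) * a⁻¹ * (h : E)⁻¹)) * (h : E) := by rw [c1]
      _ = a * (((hK.coord h : E))⁻¹ * (h : E)) * a⁻¹ := by group

/-- **Conjugate complements have the same class.** [cite: Brown1982CohomologyGroups, Ch. IV §2 Prop. 2.1 and Prop. 2.3] -/
theorem classOf_conj (hK : IsClosedComplement A H K) (hA : IsCompact (A : Set E)) {a : E} (ha : a ∈ A) :
    (hK.conj ha).classOf hA = hK.classOf hA := by
  symm
  refine (ContH1.mk_eq_mk_iff H _ _ _ _).mpr ⟨⟨a, ha⟩, fun h => Subtype.ext ?_⟩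
  rw [Subgroup.coe_mul, Subgroup.coe_inv, hK.coord_conj ha h, Subgroup.coe_mul, Subgroup.coe_inv,
    MulAut.conjNormal_apply, MonoidHom.id_apply]
  group

omit [IsMulCommutative A] [IsTopologicalGroup E] in
/-- If the coordinates of two closed complements differ by the coboundary of `a`, then `aKa⁻¹ ≤ K'`.
[cite: Brown1982CohomologyGroups, Ch. IV §2 Prop. 2.1 and Prop. 2.3] -/
theorem conj_le_of_coord (hK : IsClosedComplement A H K) {K' : Subgroup E} (hK' : IsClosedComplement A H K')
    {a : E}
    (hcob : ∀ h : H, ((hK.coord h : E))⁻¹ * (hK'.coord h : E) = (h : E) * a * (h : E)⁻¹ * a⁻¹) :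
    MulAut.conj a • K ≤ K' := by
  intro y hy
  rw [Subgroup.mem_smul_pointwise_iff_exists] at hy
  obtain ⟨k, hk, rfl⟩ := hy
  rw [MulAut.smul_def, MulAut.conj_apply]
  have hkH : k ∈ H := hK.le hk
  have h1 : (hK'.coord ⟨k, hkH⟩ : E) = k * a * k⁻¹ * a⁻¹ := by
    have := hcob ⟨k, hkH⟩
    rwa [show hK.coord ⟨k, hkH⟩ = 1 from hK.coord_apply_of_mem_right hk, Subgroup.coe_one, inv_one,
      one_mul] at this
  have h2 := hK'.coord_inv_mul_mem ⟨k, hkH⟩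
  rw [h1] at h2
  have h3 : (k * a * k⁻¹ * a⁻¹)⁻¹ * k = a * k * a⁻¹ := by group
  rwa [h3] at h2

/-- **Same class ⇒ conjugate complements.** [cite: Brown1982CohomologyGroups, Ch. IV §2 Prop. 2.1 and Prop. 2.3] -/
theorem eq_conj_of_classOf_eq (hK : IsClosedComplement A H K) {K' : Subgroup E} (hK' : IsClosedComplement A H K')
    (hA : IsCompact (A : Set E)) (h : hK.classOf hA = hK'.classOf hA) :
    ∃ a ∈ A, K' = MulAut.conj a • K := by
  obtain ⟨a, ha⟩ := (ContH1.mk_eq_mk_iff H _ _ _ _).mp h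
  have hcob : ∀ x : H, ((hK.coord x : E))⁻¹ * (hK'.coord x : E) = (x : E) * a * (x : E)⁻¹ * (a : E)⁻¹ := by
    intro x
    have := congrArg Subtype.val (ha x)
    simpa [MulAut.conjNormal_apply] using this
  refine ⟨a, a.2, le_antisymm ?_ (hK.conj_le_of_coord hK' hcob)⟩
  -- `K' ≤ aKa⁻¹ ⇔ a⁻¹K'a ≤ K`: apply the previous lemma to `(K', K, a⁻¹)`
  have hcob' : ∀ x : H, ((hK'.coord x : E))⁻¹ * (hK.coord x : E) = (x : E) * (a : E)⁻¹ * (x : E)⁻¹ * ((a : E)⁻¹)⁻¹ := by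
    intro x
    have hx := hcob x
    have hcA : (x : E) * a * (x : E)⁻¹ ∈ A := (inferInstance : A.Normal).conj_mem _ a.2 _
    have e1 : ((hK'.coord x : E))⁻¹ * (hK.coord x : E) = (((hK.coord x : E))⁻¹ * (hK'.coord x : E))⁻¹ := by group
    rw [e1, hx]
    have hcomm : (x : E) * a * (x : E)⁻¹ * (a : E)⁻¹ = (a : E)⁻¹ * ((x : E) * a * (x : E)⁻¹) :=
      setLike_mul_comm (s := A) hcA (A.inv_mem a.2)
    rw [hcomm]
    group
  have hle := hK'.conj_le_of_coord hK hcob'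
  calc K' = MulAut.conj (a : E) • (MulAut.conj ((a : E)⁻¹) • K') := by
          rw [← mul_smul, ← map_mul, mul_inv_cancel, map_one, one_smul]
    _ ≤ MulAut.conj (a : E) • K := Subgroup.pointwise_smul_le_pointwise_smul_iff.mpr hle

/-! #### Every class restricting to `[id]` comes from a closed complement (closed `H`) -/

/-- A cocycle `f` on `H` with `f|_A = id` has kernel a CLOSED complement whose coordinate is `f` — so its
class is a `classOf`. [cite: Brown1982CohomologyGroups, Ch. IV §2 Prop. 2.1 and Prop. 2.3] -/
theorem exists_of_cocycle [T1Space E] (hAH : A ≤ H) (hH : IsClosed (H : Set E)) (hA : IsCompact (A : Set E))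
    (f : contCocycles (MonoidHom.id E) A H) (hf : ∀ a : A, f.1 ⟨a, hAH a.2⟩ = a) :
    ∃ (K : Subgroup E) (hK : IsClosedComplement A H K), hK.classOf hA = ContH1.mk f.1 f.2 := by
  obtain ⟨K, hKH, -, hdisj, hπK, hmem⟩ := exists_complement_of_cocycle hAH f hf
  have hKcl : IsClosed (K : Set E) := by
    have hset : (K : Set E) = Subtype.val '' ((f.1) ⁻¹' {1}) := by
      ext k
      constructor
      · intro hk
        exact ⟨⟨k, hKH hk⟩, (hmem ⟨k, hKH hk⟩).mp hk, rfl⟩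
      · rintro ⟨h, hh, rfl⟩
        exact (hmem h).mpr hh
    rw [hset]
    exact hH.isClosedEmbedding_subtypeVal.isClosedMap _ ((isClosed_singleton).preimage f.2.1)
  have hsup : A ⊔ K = H := by
    apply le_antisymm (sup_le hAH hKH)
    intro h hh
    have : (h : E) = (f.1 ⟨h, hh⟩ : E) * (((f.1 ⟨h, hh⟩ : E))⁻¹ * h) := by rw [mul_inv_cancel_left]
    rw [this]
    exact Subgroup.mul_mem _ (Subgroup.mem_sup_left (f.1 _).2) (Subgroup.mem_sup_right (hπK ⟨h, hh⟩))
  let hK : IsClosedComplement A H K := ⟨hKcl, hKH, hdisj, hsup⟩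
  refine ⟨K, hK, ContH1.mk_congr H (funext fun h => ?_) _ _⟩
  exact Subtype.ext (hK.coord_eq_of_inv_mul_mem h (f.1 h).2 (hπK h))

/-- **Every class restricting to `[id]` is the class of a closed complement** (for `H` closed, `A` compact).
[cite: Brown1982CohomologyGroups, Ch. IV §2 Prop. 2.1 and Prop. 2.3] -/
theorem exists_of_res_eq [T1Space E] (hAH : A ≤ H) (hH : IsClosed (H : Set E)) (hA : IsCompact (A : Set E))
    (x : ContH1 (MonoidHom.id E) A H)
    (hx : ContH1.res (MonoidHom.id E) A hAH x = ContH1.mk (fun a : A => a) id_mem_contCocycles) :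
    ∃ (K : Subgroup E) (hK : IsClosedComplement A H K), hK.classOf hA = x := by
  induction x using QuotientGroup.induction_on with
  | H f =>
    have hres : ContH1.mk _ (ContH1.resCocycle (MonoidHom.id E) A hAH f).2 =
        ContH1.mk (fun a : A => a) id_mem_contCocycles := hx
    have hfA : ∀ a : A, f.1 ⟨a, hAH a.2⟩ = a := fun a =>
      congrFun (cocycle_eq_of_mk_eq_self _ _ _ _ hres) a
    exact exists_of_cocycle hAH hH hA f hfA

end IsClosedComplement

/-! ### The torsor: conjugacy classes of closed complements ≃ a coset of `Ker(res)` -/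

section Torsor

variable (A H)

/-- The set of closed complements of `A` in `H`. [cite: MochizukiGalSect2005, §4 p.33] -/
def closedComplements : Set (Subgroup E) := {K | IsClosedComplement A H K}

/-- `A`-conjugacy of subgroups. [cite: MochizukiGalSect2005, §4 p.33] -/
def AConj (K K' : Subgroup E) : Prop := ∃ a ∈ A, K' = MulAut.conj a • K

/-- `A`-conjugacy is an equivalence relation on closed complements. [cite: MochizukiGalSect2005, §4 p.33] -/
def complementSetoid : Setoid (closedComplements A H) where
  r K K' := AConj A K.1 K'.1
  iseqv :=
    ⟨fun K => ⟨1, A.one_mem, by simp⟩,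
      fun ⟨a, ha, h⟩ => ⟨a⁻¹, A.inv_mem ha, by rw [h, map_inv, inv_smul_smul]⟩,
      fun ⟨a, ha, h⟩ ⟨b, hb, h'⟩ => ⟨b * a, A.mul_mem hb ha, by rw [h', h, map_mul, mul_smul]⟩⟩

/-- **The classes of closed complements modulo `A`-conjugation** (the "splitting classes").
[cite: MochizukiGalSect2005, §4 p.33] -/
def ComplementClass : Type _ := Quotient (complementSetoid A H)

/-- The fibre of `res` over `[id]`: `{x ∈ H¹(H, A) | res_A x = [id]}`. [cite: Brown1982CohomologyGroups, Ch. IV §2 Prop. 2.1 and Prop. 2.3] -/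
def idFibre (hAH : A ≤ H) : Set (ContH1 (MonoidHom.id E) A H) :=
  {x | ContH1.res (MonoidHom.id E) A hAH x = ContH1.mk (fun a : A => a) id_mem_contCocycles}

/-- `Ker(res : H¹(H, A) → H¹(A, A))` (`≅ H¹(H/A, A^{?})` by inflation–restriction; for [GalSect] §4,
`H¹(D_x/I_x, I_x) = H¹(G_K, Ẑ(1))`). [cite: Brown1982CohomologyGroups, Ch. IV §2 Prop. 2.1 and Prop. 2.3] -/
abbrev resKer (hAH : A ≤ H) : Subgroup (ContH1 (MonoidHom.id E) A H) := (ContH1.res (MonoidHom.id E) A hAH).ker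

variable {A H}

/-- The fibre is a COSET of `Ker(res)`: given a base point `x₀`, `y ↦ x₀⁻¹ y` is a bijection onto the kernel.
[cite: Brown1982CohomologyGroups, Ch. IV §2 Prop. 2.1 and Prop. 2.3] -/
def idFibreEquivResKer {hAH : A ≤ H} (x₀ : idFibre A H hAH) : idFibre A H hAH ≃ resKer A H hAH where
  toFun y := ⟨x₀.1⁻¹ * y.1, by
    rw [MonoidHom.mem_ker, map_mul, map_inv]
    have h0 : ContH1.res (MonoidHom.id E) A hAH x₀.1 = _ := x₀.2
    have h1 : ContH1.res (MonoidHom.id E) A hAH y.1 = _ := y.2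
    rw [h0, h1, inv_mul_cancel]⟩
  invFun k := ⟨x₀.1 * k.1, by
    change ContH1.res _ A hAH (x₀.1 * k.1) = _
    have h0 : ContH1.res (MonoidHom.id E) A hAH x₀.1 = _ := x₀.2
    rw [map_mul, h0, MonoidHom.mem_ker.mp k.2, mul_one]⟩
  left_inv y := Subtype.ext (mul_inv_cancel_left _ _)
  right_inv k := Subtype.ext (inv_mul_cancel_left _ _)

/-- [cite: Brown1982CohomologyGroups, Ch. IV §2 Prop. 2.1 and Prop. 2.3] -/
@[simp] theorem coe_idFibreEquivResKer_apply {hAH : A ≤ H} (x₀ : idFibre A H hAH) (y : idFibre A H hAH) :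
    (idFibreEquivResKer x₀ y).1 = x₀.1⁻¹ * y.1 := rfl

/-- `classOf` on closed complements lands in the fibre. [cite: Brown1982CohomologyGroups, Ch. IV §2 Prop. 2.1 and Prop. 2.3] -/
theorem classOf_mem_idFibre (hA : IsCompact (A : Set E)) (K : closedComplements A H) :
    K.2.classOf hA ∈ idFibre A H K.2.le_left :=
  K.2.res_classOf hA

/-- **The classifying map** `ComplementClass → idFibre`, `[K] ↦ [π_K]` (well defined by `classOf_conj`).
[cite: Brown1982CohomologyGroups, Ch. IV §2 Prop. 2.1 and Prop. 2.3] -/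
def classify (hAH : A ≤ H) (hA : IsCompact (A : Set E)) : ComplementClass A H → idFibre A H hAH :=
  Quotient.lift (fun K : closedComplements A H => (⟨K.2.classOf hA, K.2.res_classOf hA⟩ : idFibre A H hAH))
    (by
      rintro K K' ⟨a, ha, h⟩
      apply Subtype.ext
      change K.2.classOf hA = K'.2.classOf hA
      have hc : IsClosedComplement A H (MulAut.conj a • K.1) := K.2.conj ha
      have e1 : K'.2.classOf hA = hc.classOf hA := by
        obtain ⟨K', hK'⟩ := K'
        subst h
        rfl
      rw [e1, K.2.classOf_conj hA ha])

/-- The classifying map on a class. [cite: Brown1982CohomologyGroups, Ch. IV §2 Prop. 2.1 and Prop. 2.3] -/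
theorem classify_mk (hAH : A ≤ H) (hA : IsCompact (A : Set E)) (K : closedComplements A H) :
    (classify hAH hA (Quotient.mk (complementSetoid A H) K) : ContH1 _ A H) = K.2.classOf hA := rfl

/-- `classify` is injective (same class ⇒ conjugate). [cite: Brown1982CohomologyGroups, Ch. IV §2 Prop. 2.1 and Prop. 2.3] -/
theorem classify_injective (hAH : A ≤ H) (hA : IsCompact (A : Set E)) : Function.Injective (classify hAH hA) := by
  intro c c' h
  induction c using Quotient.inductionOn with
  | h K =>
    induction c' using Quotient.inductionOn with
    | h K' =>
      apply Quotient.sound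
      have h' : K.2.classOf hA = K'.2.classOf hA := congrArg Subtype.val h
      exact K.2.eq_conj_of_classOf_eq K'.2 hA h'

/-- `classify` is surjective (for `H` closed). [cite: Brown1982CohomologyGroups, Ch. IV §2 Prop. 2.1 and Prop. 2.3] -/
theorem classify_surjective [T1Space E] (hAH : A ≤ H) (hH : IsClosed (H : Set E)) (hA : IsCompact (A : Set E)) :
    Function.Surjective (classify hAH hA) := by
  rintro ⟨x, hx⟩
  obtain ⟨K, hK, hKx⟩ := IsClosedComplement.exists_of_res_eq hAH hH hA x hx
  exact ⟨Quotient.mk _ ⟨K, hK⟩, Subtype.ext hKx⟩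

/-- **Conjugacy classes of closed complements ≃ the fibre of `res` over `[id]`** (`A` compact abelian
normal, `H ≥ A` closed). [cite: Brown1982CohomologyGroups, Ch. IV §2 Prop. 2.1 and Prop. 2.3] -/
def complementClassEquivIdFibre [T1Space E] (hAH : A ≤ H) (hH : IsClosed (H : Set E)) (hA : IsCompact (A : Set E)) :
    ComplementClass A H ≃ idFibre A H hAH :=
  Equiv.ofBijective (classify hAH hA) ⟨classify_injective hAH hA, classify_surjective hAH hH hA⟩

/-- **The torsor statement**: once ONE closed complement exists, the conjugacy classes of closed
complements are in bijection with `Ker(res : H¹(H, A) → H¹(A, A))` — they form a torsor under it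
(translate the fibre-coset by the base point). [cite: Brown1982CohomologyGroups, Ch. IV §2 Prop. 2.1 and Prop. 2.3] -/
def complementClassEquivResKer [T1Space E] {K₀ : Subgroup E} (hK₀ : IsClosedComplement A H K₀)
    (hH : IsClosed (H : Set E)) (hA : IsCompact (A : Set E)) : ComplementClass A H ≃ resKer A H hK₀.le_left :=
  (complementClassEquivIdFibre hK₀.le_left hH hA).trans
    (idFibreEquivResKer ⟨hK₀.classOf hA, hK₀.res_classOf hA⟩)

/-- The base complement goes to `1 ∈ Ker(res)`. [cite: Brown1982CohomologyGroups, Ch. IV §2 Prop. 2.1 and Prop. 2.3] -/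
theorem complementClassEquivResKer_base [T1Space E] {K₀ : Subgroup E} (hK₀ : IsClosedComplement A H K₀)
    (hH : IsClosed (H : Set E)) (hA : IsCompact (A : Set E)) :
    complementClassEquivResKer hK₀ hH hA (Quotient.mk _ ⟨K₀, hK₀⟩) = 1 :=
  Subtype.ext (by
    change (hK₀.classOf hA)⁻¹ * hK₀.classOf hA = 1
    exact inv_mul_cancel _)

end Torsor

end ContH1

end Literature.AnabelianGeometry.EtaleTheta

end
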